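import Literature.IUT.HodgeTheaters.PuncturedEllipticCoveringsCor12IotaNegOfOrigin
import Literature.IUT.HodgeTheaters.PuncturedEllipticCoveringsCor12CuspSpanOfRelation
import Literature.IUT.HodgeTheaters.PuncturedEllipticCoveringsEps0OrientedProductOfTransfer
import Literature.IUT.HodgeTheaters.PuncturedEllipticCoveringsEps0OrientationOfIotaNeg
import HarnessLib

/-!
# [IUTchI] §1 p. 38 l. 1 / Cor. 1.2: the law (L3) «`ι` acts on `Δ_E ⊗ (ℤ/lℤ)` by `−1`» and the cusp-span sentence (CS)
# are THEOREMS of the origin records `GeomOrigin` / `GeomOriginIota` and the cusp action `CuspGalois` (proof-only knit)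

Mochizuki, *Inter-universal Teichmüller theory I: construction of Hodge theaters*, kurims manuscript (May 2020), §1 p. 37
l. 30 – p. 38 l. 1 ("`Δ_X̲ ↠ Δ_X̲^{ab} ⊗ (ℤ/lℤ) ↠ Δ_ε` … a natural exact sequence `0 → I_ε′ × I_ε″ → Δ_ε → Δ_E ⊗ (ℤ/lℤ) → 0`
… `ι` acts on `Δ_E ⊗ (ℤ/lℤ)` via multiplication by `−1`") and Cor. 1.2 p. 39 [cite: Mochizuki2012, IUTchI §1 pp.37-39]
(D-0012 claim key; series status DISPUTED — nothing of the series is asserted here); [EtTh] §2 Def. 2.1 p. 33 (`C = X/{±1}`)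
[cite: MochizukiEtTh2009, Def 2.1 p.33].

PROOF-ONLY knit (cell abc-iut, seat abc-iut-L5-t1 gen 12; L5 ROWS #7 R48 «COR12-KNIT», standing row of this lineage; HUB
census `plan/L5/SUBDAG-IUTchI-Cor12.md`).  No `def`, no instance, no notation, no new `Prop` fact; every step BY NAME:
* `GeomOrigin.closure_commutator_le_cuspSpan (O) (C)` — **(CS) `⁅Δ_X, Δ_X⁆⁻ ≤ I_ε′ ⊔ I_ε″ ⊔ Ker(Δ_X̲ ↠ Δ_ε)` with NO law
  binder**: this lineage's `GeomOrigin.closure_commutator_le_span (O) (C) (hrel)` (p506512: (CS) ⟸ (REL′)) fed with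
  abc-iut-w6-d032's THEOREM `GeomOrigin.inertia_ε0_le_span (O) (C)` (p506921: (REL′) «`I_{ε⁰} ≤ I_{ε′}·I_{ε″}·Ker`» by the
  transfer `Δ_X → Δ_X̲^{ab}`);
* `GeomOriginIota.iota_neg (O) (C)` — **the law (L3) `ModLCuspLaws.iota_neg`** («`ι̲ v ι̲⁻¹ · v ∈ I_ε′ · I_ε″ · Ker(Δ_X̲ ↠ Δ_ε)`
  for `ι̲ ∈ Δ_C̲ ∖ Δ_X̲`, `v ∈ Δ_X̲`», VERBATIM the binders `hL3 hL3′` of the Cor. 1.2 closer of record «cor12_v14»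
  `InitialThetaData.pe_characteristicNatureOfCoverings_of_geomOrigin_ex48_cuspGalois`, p502506) from the record
  `GeomOriginIota` and the cusp action ALONE: this lineage's `GeomOriginIota.iota_neg_of_closure_commutator_le` (p502003:
  (L3) ⟸ (CS)) ∘ (CS);
* `GeomOriginIota.conj_mul_mem_commutator_sup_powers (O)` — the sentence (N) «every `c ∈ Δ_C̲ ∖ Δ_X̲` acts by `−1` on
  `Δ_X^{ab} ⊗ ℤ/l`» in the EXACT binder shape `hneg` of abc-iut-w6-d032's (O2)-theorem
  `CuspGalois.inertia_ε0_conj_mem_modLKer_of_iotaNeg_freePro` (p503354) — the by-name glue from p502003's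
  `conj_mul_mem_closure_commutator_of_not_mem_piX` (monotonicity of the closure along `⁅Δ_X,Δ_X⁆ ≤ ⁅Δ_X,Δ_X⁆ ⊔ ⟨l-th powers⟩`);
* `GeomOriginIota.inertia_ε0_conj_mem_modLKer (O) (C)` — hence the orientation law (O2) «the geometric involution carries a
  generator of `I_{ε⁰}` to a conjugate of itself modulo `Ker(Δ_X̲ ↠ Δ_X̲^{ab} ⊗ ℤ/l)`» (the binder `hfix` of p499258) from
  the record and the cusp action alone (ONE CALL of p503354).
EFFECT on the telescope of «cor12_v14» (LAW = the six `Δ_ε` sentences (L2a)(L2c)(L3) ×2 · GAP `h0 h0′`): `hL3 hL3′` are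
DISCHARGED at `GeomOriginIota` records (this file); (L2a)(L2c) are abc-iut-L5-d4's R45 (`PuncturedEllipticProLModelLabels`,
announced 07:04Z); `h0 ⟸` (O1) (p506921) + (O2) (this file / p503354) + the labels is abc-iut-w6-d032's knit «v15».  The
LAW-0 / GAP-0 closer is then ONE composition (R48: whoever lands last knits).

HONEST FRAMING: classical profinite group theory over hypothesis/ORIGIN records (`GeomOrigin`, `GeomOriginIota`) and the
interface datum `CuspGalois`, all asserted for no instance (non-vacuity of the records: abc-iut-L4-t15's profinite models
p500503 / p500947 / p501711); typed ≠ inhabited ≠ discharged; no FACT-LIST item is discharged here; nothing in this file bears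
on [IUTchIII] Cor. 3.12 or asserts that abc is proved or refuted; no printed statement is strengthened.
-/

noncomputable section

open Topology

namespace Literature.IUT.HodgeTheaters

namespace PuncturedEllipticData

open Literature.AnabelianGeometry.AbsoluteAnabelian

universe u

variable {D : PuncturedEllipticData.{u}}

/-! ### §1. (CS) with no law binder -/

/-- **(CS) over the origin record and the cusp action, NO law binder**: `⁅Δ_X, Δ_X⁆⁻ ≤ I_ε′ ⊔ I_ε″ ⊔ Ker(Δ_X̲ ↠ Δ_ε)` —
«the commutators of `Δ_X` die in `Δ_E ⊗ ℤ/l = Δ_ε/(I_ε′ × I_ε″)`» (p. 37 l. 30 – p. 38 l. 1): p506512's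
`GeomOrigin.closure_commutator_le_span` with its one displayed relation (REL′) supplied by p506921's
`GeomOrigin.inertia_ε0_le_span`. ([IUTchI] §1 p.38) [claim: Mochizuki2012, status: disputed] -/
theorem GeomOrigin.closure_commutator_le_cuspSpan (O : D.GeomOrigin) (C : D.CuspGalois) :
    (⁅D.PiX ⊓ D.DeltaC, D.PiX ⊓ D.DeltaC⁆).topologicalClosure ≤
      D.inertia D.ε1 ⊔ D.inertia D.ε2 ⊔ D.deltaEpsKer :=
  O.closure_commutator_le_span C (O.inertia_ε0_le_span C)

/-! ### §2. The law (L3) at a `GeomOriginIota` record -/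

/-- **The law (L3) «`ι` acts on `Δ_E ⊗ (ℤ/lℤ)` via multiplication by `−1`» is a THEOREM of the record `GeomOriginIota`
and the cusp action**: for `ι̲ ∈ Δ_C̲ ∖ Δ_X̲` and `v ∈ Δ_X̲`, `ι̲ v ι̲⁻¹ · v ∈ I_ε′ ⊔ I_ε″ ⊔ Ker(Δ_X̲ ↠ Δ_ε)` — VERBATIM the
binder `hL3` (and, at the second datum, `hL3′`) of the closer «cor12_v14» (p502506); p502003's
`iota_neg_of_closure_commutator_le` ∘ `GeomOrigin.closure_commutator_le_cuspSpan`.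
([IUTchI] §1 p.38, Cor 1.2 p.39) [claim: Mochizuki2012, status: disputed] -/
theorem GeomOriginIota.iota_neg (O : D.GeomOriginIota) (C : D.CuspGalois) :
    ∀ c ∈ D.DeltaCbar, c ∉ D.DeltaXbar → ∀ v ∈ D.DeltaXbar,
      c * v * c⁻¹ * v ∈ D.inertia D.ε1 ⊔ D.inertia D.ε2 ⊔ D.deltaEpsKer :=
  O.iota_neg_of_closure_commutator_le (O.toGeomOrigin.closure_commutator_le_cuspSpan C)

/-! ### §3. The sentence (N) in the binder shape of p503354, and the orientation law (O2) -/

/-- **(N) «every `c ∈ Δ_C̲ ∖ Δ_X̲` acts by `−1` on `Δ_X^{ab} ⊗ ℤ/l`»** in the exact shape of the binder `hneg` of p503354's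
`CuspGalois.inertia_ε0_conj_mem_modLKer_of_iotaNeg_freePro`: `c p c⁻¹ p ∈ (⁅Δ_X,Δ_X⁆ ⊔ ⟨p^l⟩)⁻` for `p ∈ Δ_X` — from
p502003's `conj_mul_mem_closure_commutator_of_not_mem_piX` (`∈ ⁅Δ_X,Δ_X⁆⁻`) by monotonicity of the closure.
([IUTchI] §1 p.38) [claim: Mochizuki2012, status: disputed] -/
theorem GeomOriginIota.conj_mul_mem_commutator_sup_powers (O : D.GeomOriginIota) :
    ∀ c ∈ D.DeltaCbar, c ∉ D.DeltaXbar → ∀ p ∈ D.PiX ⊓ D.DeltaC,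
      c * p * c⁻¹ * p ∈ (⁅D.PiX ⊓ D.DeltaC, D.PiX ⊓ D.DeltaC⁆ ⊔
        Subgroup.closure ((fun y : D.PiC => y ^ D.l) ''
          ((D.PiX ⊓ D.DeltaC : Subgroup D.PiC) : Set D.PiC))).topologicalClosure := by
  intro c hc hcX p hp
  have hcC : c ∈ D.DeltaC := (Subgroup.mem_inf.mp hc).2
  have hcCbar : c ∈ D.PiCbar := (Subgroup.mem_inf.mp hc).1
  have hcX' : c ∉ D.PiX := fun h =>
    hcX (Subgroup.mem_inf.mpr ⟨Subgroup.mem_inf.mpr ⟨h, hcCbar⟩, hcC⟩)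
  exact Subgroup.topologicalClosure_mono le_sup_left
    (O.conj_mul_mem_closure_commutator_of_not_mem_piX hcC hcX' hp)

/-- **The orientation law (O2) at a `GeomOriginIota` record** (the binder `hfix` of p499258's
`not_inertia_ε0_le_piXarrow_of_orientedInertia`): for `c ∈ Δ_C̲ ∖ Δ_X̲` and `z ∈ I_{ε⁰}`, `c z c⁻¹ z⁻¹ ∈
Ker(Δ_X̲ ↠ Δ_X̲^{ab} ⊗ ℤ/l)` — ONE CALL of abc-iut-w6-d032's p503354 with (A) (c′) from the record and (N) from
`conj_mul_mem_commutator_sup_powers`. ([IUTchI] Cor 1.2 p.39) [claim: Mochizuki2012, status: disputed] -/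
theorem GeomOriginIota.inertia_ε0_conj_mem_modLKer (O : D.GeomOriginIota) (C : D.CuspGalois) :
    ∀ c ∈ D.DeltaCbar, c ∉ D.DeltaXbar → ∀ z ∈ D.inertia D.ε0,
      c * z * c⁻¹ * z⁻¹ ∈ D.modLKer :=
  C.inertia_ε0_conj_mem_modLKer_of_iotaNeg_freePro O.isFreeProOn O.inertia_eq_conj_commutator
    O.conj_mul_mem_commutator_sup_powers

end PuncturedEllipticData

end Literature.IUT.HodgeTheaters

end
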